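import Mathlib
import Summits.NavierStokesRegularity.NavierStokesRegularity.Theorems.ThreadingFluxAzimuthalCartanCrossFlowField
import HarnessLib

/-!
# Crux `PoloidalLiouville` (stmt-NavierStokesRegularity-1222, wall W1), crux idea «azimuthal-cartan-test» (ns-idea-15 g10):
# THE SECTORIAL CROSS FLOW IS A STEADY NAVIER–STOKES FLOW on the half-space (K♭, the dynamical part)

Support file (`--supports stmt-NavierStokesRegularity-1222`, helper; cell `ns-wall-extremal`, width hand ns-wall-eng-7 g7, 0 kit).
With `u = crossFlow γ`, `p = crossFlowPressure γ = −|u|²/2 + G(ρ)²/2` (Defs twin), at every `x` with `0 < x₀`: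

* `analyticAt_crossFlow`, `contDiffOn_crossFlow_ball`, `laplacian_crossFlow` — `Δu(x) = −(2γ log ρ · k) e₂`, `k = e^{−γ log²ρ}/ρ²`
  (LOCAL `Δ = −curl curl`, `…LocalCurlCurl`, with `curl u = k (x₁, −x₀, 0)` and `curl` of that from `…CrossFlowField`);
* `crossFlowPressure_eq` — `p = −2γ² (φ² + log²ρ)/ρ²` on the half-space (the vertical kinetic energy cancels `G²/2`);
  `hasFDerivAt_pressureFormula`, `analyticAt_crossFlowPressure`, `gradient_crossFlowPressure` (explicit);
* ★ `crossFlow_momentum` — `Du(x)[u(x)] + ∇p(x) = Δu(x)`: the steady Navier–Stokes equation, a finite identity after the above;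
* ★ `isSteadyNSOn_crossFlow` — `IsSteadyNSOn (ball xTest 1) (crossFlow γ) (crossFlowPressure γ)`, and the analyticity clauses
  `analyticOnNhd_crossFlow_ball`, `analyticOnNhd_crossFlowPressure_ball`.

HONEST FRAME: an explicit steady flow on a ball off the axis (class in print: potential cross flow + axial advection–diffusion profile,
Weinbaum–O'Brien 1967; this member is the card's); closes no crux or sketch Prop by itself; `PoloidalLiouville` (1222) and NS regularity OPEN.
-/

-- the summit and its single sub-problem share the name (CONVENTIONS §1)
set_option linter.dupNamespace false

noncomputable section

namespace Summit.NavierStokesRegularity.NavierStokesRegularity.Theorems.PoloidalLiouville.AzimuthalCartan.CrossFlow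

open Set Function Filter Topology Metric
open scoped ContDiff RealInnerProductSpace
open Literature.Analysis.FluidPDE (curl)
open Summit.NavierStokesRegularity.NavierStokesRegularity.Theorems.PoloidalLiouville.CentreJet (E3 IsSteadyNSOn)
open Summit.NavierStokesRegularity.NavierStokesRegularity.Theorems.PoloidalLiouville.AzimuthalCartan.HalfSpace
open Summit.NavierStokesRegularity.NavierStokesRegularity.Theorems.PoloidalLiouville.AzimuthalCartan.Axial

variable (γ : ℝ) {x : E3}

/-! ### Analyticity and the Laplacian -/

/-- The cross flow is analytic on the half-space. -/
theorem analyticAt_crossFlow (hx : 0 < x 0) : AnalyticAt ℝ (crossFlow γ) x := by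
  rw [crossFlow_eq]
  have hG : AnalyticAt ℝ (fun y : E3 => crossFlowAxial γ (cylRadius y)) x :=
    AnalyticAt.comp (analyticAt_crossFlowAxial γ (cylRadius_pos hx)) (analyticAt_cylRadius hx)
  exact (((analyticAt_const.mul (analyticAt_potComp0 hx)).smul analyticAt_const).add
    ((analyticAt_const.mul (analyticAt_potComp1 hx)).smul analyticAt_const)).add (hG.smul analyticAt_const)

/-- The cross flow is `Cⁿ` on the ball of radius `x₀` about a point of the half-space. -/
theorem contDiffOn_crossFlow_ball {n : WithTop ℕ∞} : ContDiffOn ℝ n (crossFlow γ) (ball x (x 0)) := fun _ hy =>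
  ((analyticAt_crossFlow γ (apply_zero_pos_of_mem_ball_self hy)).contDiffAt (n := n)).contDiffWithinAt

/-- **`Δu(x) = −(2γ log ρ · k) • e₂`.** -/
theorem laplacian_crossFlow (hx : 0 < x 0) :
    Laplacian.laplacian (crossFlow γ) x =
      -((2 * γ * Real.log (cylRadius x) * (Real.exp (-(γ * Real.log (cylRadius x) ^ 2)) / (x 0 ^ 2 + x 1 ^ 2))) •
        (EuclideanSpace.single 2 (1 : ℝ) : E3)) := by
  rw [LocalCurlCurl.laplacian_eq_neg_curl_local hx (contDiffOn_crossFlow_ball γ)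
    (fun y hy => divergence_crossFlow γ (apply_zero_pos_of_mem_ball_self hy))
    (w := fun y : E3 =>
      (Real.exp (-(γ * Real.log (cylRadius y) ^ 2)) / (y 0 ^ 2 + y 1 ^ 2) * y 1) • (EuclideanSpace.single 0 (1 : ℝ) : E3) +
      (-(Real.exp (-(γ * Real.log (cylRadius y) ^ 2)) / (y 0 ^ 2 + y 1 ^ 2) * y 0)) • (EuclideanSpace.single 1 (1 : ℝ) : E3))
    (fun y hy => curl_crossFlow γ (apply_zero_pos_of_mem_ball_self hy)),
    curl_vort γ rfl hx]

/-! ### The pressure -/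

/-- **`p = −2γ²(φ² + log²ρ)/ρ²`** on the half-space. -/
theorem crossFlowPressure_eq (hx : 0 < x 0) :
    crossFlowPressure γ x = -(2 * γ ^ 2) * (azimuth x ^ 2 + Real.log (cylRadius x) ^ 2) / (x 0 ^ 2 + x 1 ^ 2) := by
  have hs := cylSq_pos hx
  rw [crossFlowPressure, EuclideanSpace.real_norm_sq_eq, Fin.sum_univ_three, crossFlow_apply_zero, crossFlow_apply_one,
    crossFlow_apply_two, HalfSpace.cylRadius_sq]
  field_simp
  ring

/-- The derivative of the pressure formula `q = −2γ²(φ² + log²ρ)/s`. -/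
theorem hasFDerivAt_pressureFormula (hx : 0 < x 0) :
    HasFDerivAt (fun y : E3 => -(2 * γ ^ 2) * (azimuth y ^ 2 + Real.log (cylRadius y) ^ 2) / (y 0 ^ 2 + y 1 ^ 2))
      ((-(4 * γ ^ 2) / (x 0 ^ 2 + x 1 ^ 2) ^ 2) •
        ((-(azimuth x) * x 1 + Real.log (cylRadius x) * x 0 - (azimuth x ^ 2 + Real.log (cylRadius x) ^ 2) * x 0) •
            (EuclideanSpace.proj 0 : E3 →L[ℝ] ℝ) +
          (azimuth x * x 0 + Real.log (cylRadius x) * x 1 - (azimuth x ^ 2 + Real.log (cylRadius x) ^ 2) * x 1) •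
            (EuclideanSpace.proj 1 : E3 →L[ℝ] ℝ)))
      x := by
  have hs := cylSq_pos hx
  have hM := (((hasFDerivAt_azimuth hx).pow 2).add ((hasFDerivAt_logCyl hx).pow 2)).const_mul (-(2 * γ ^ 2))
  have h := hasFDerivAt_div hM (hasFDerivAt_cylSq x) hs.ne'
  refine (h.congr_fderiv ?_).congr_of_eventuallyEq (Eventually.of_forall fun y => by simp only [Pi.add_apply])
  ext v
  simp only [add_apply, sub_apply, smul_apply, smul_eq_mul, proj_apply', Pi.add_apply]
  field_simp
  ring

/-- The pressure agrees with the formula near every point of the half-space. -/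
theorem crossFlowPressure_eventuallyEq (hx : 0 < x 0) :
    crossFlowPressure γ =ᶠ[𝓝 x]
      fun y : E3 => -(2 * γ ^ 2) * (azimuth y ^ 2 + Real.log (cylRadius y) ^ 2) / (y 0 ^ 2 + y 1 ^ 2) := by
  filter_upwards [isOpen_halfSpace.mem_nhds hx] with y hy using crossFlowPressure_eq γ hy

/-- The pressure is analytic on the half-space. -/
theorem analyticAt_crossFlowPressure (hx : 0 < x 0) : AnalyticAt ℝ (crossFlowPressure γ) x := by
  have h : AnalyticAt ℝ (fun y : E3 => -(2 * γ ^ 2) * (azimuth y ^ 2 + Real.log (cylRadius y) ^ 2) / (y 0 ^ 2 + y 1 ^ 2)) x :=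
    (analyticAt_const.mul (((analyticAt_azimuth hx).pow 2).add ((analyticAt_logCyl hx).pow 2))).div (analyticAt_cylSq x)
      (cylSq_pos hx).ne'
  exact h.congr (crossFlowPressure_eventuallyEq γ hx).symm

/-- **The pressure gradient**, explicitly. -/
theorem gradient_crossFlowPressure (hx : 0 < x 0) :
    gradient (crossFlowPressure γ) x =
      ((-(4 * γ ^ 2) / (x 0 ^ 2 + x 1 ^ 2) ^ 2) *
          (-(azimuth x) * x 1 + Real.log (cylRadius x) * x 0 - (azimuth x ^ 2 + Real.log (cylRadius x) ^ 2) * x 0)) •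
        (EuclideanSpace.single 0 (1 : ℝ) : E3) +
      ((-(4 * γ ^ 2) / (x 0 ^ 2 + x 1 ^ 2) ^ 2) *
          (azimuth x * x 0 + Real.log (cylRadius x) * x 1 - (azimuth x ^ 2 + Real.log (cylRadius x) ^ 2) * x 1)) •
        (EuclideanSpace.single 1 (1 : ℝ) : E3) := by
  have hD := (hasFDerivAt_pressureFormula γ hx).congr_of_eventuallyEq (crossFlowPressure_eventuallyEq γ hx)
  refine HasGradientAt.gradient (hasGradientAt_iff_hasFDerivAt.2 (hD.congr_fderiv ?_))
  ext v
  rw [InnerProductSpace.toDual_apply_apply]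
  simp only [add_apply, smul_apply, smul_eq_mul, proj_apply', inner_add_left, inner_smul_left, EuclideanSpace.inner_single_left,
    map_one, one_mul, conj_trivial]
  ring

/-! ### The steady Navier–Stokes equation -/

/-- ★ **The momentum equation** `Du(x)[u(x)] + ∇p(x) = Δu(x)` on the half-space. -/
theorem crossFlow_momentum (hx : 0 < x 0) :
    fderiv ℝ (crossFlow γ) x (crossFlow γ x) + gradient (crossFlowPressure γ) x = Laplacian.laplacian (crossFlow γ) x := by
  have hs := cylSq_pos hx
  rw [fderiv_crossFlow_apply γ hx, gradient_crossFlowPressure γ hx, laplacian_crossFlow γ hx, crossFlow_apply_zero,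
    crossFlow_apply_one, HalfSpace.cylRadius_sq]
  ext i
  fin_cases i
  · simp
    field_simp
    ring
  · simp
    field_simp
    ring
  · simp
    field_simp
    ring

/-- The cross flow is analytic on `ball xTest 1`. -/
theorem analyticOnNhd_crossFlow_ball : AnalyticOnNhd ℝ (crossFlow γ) (ball xTest 1) := fun _ hy =>
  analyticAt_crossFlow γ (apply_zero_pos_of_mem_ball hy)

/-- The pressure is analytic on `ball xTest 1`. -/
theorem analyticOnNhd_crossFlowPressure_ball : AnalyticOnNhd ℝ (crossFlowPressure γ) (ball xTest 1) := fun _ hy =>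
  analyticAt_crossFlowPressure γ (apply_zero_pos_of_mem_ball hy)

/-- ★ **The sectorial cross flow is a classical steady Navier–Stokes flow on `ball xTest 1`.** -/
theorem isSteadyNSOn_crossFlow : IsSteadyNSOn (ball xTest 1) (crossFlow γ) (crossFlowPressure γ) := by
  refine ⟨?_, ?_, ?_, ?_⟩
  · exact fun y hy => ((analyticAt_crossFlow γ (apply_zero_pos_of_mem_ball hy)).contDiffAt (n := 3)).contDiffWithinAt
  · exact fun y hy => ((analyticAt_crossFlowPressure γ (apply_zero_pos_of_mem_ball hy)).contDiffAt (n := 1)).contDiffWithinAt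
  · exact fun y hy => divergence_crossFlow γ (apply_zero_pos_of_mem_ball hy)
  · exact fun y hy => crossFlow_momentum γ (apply_zero_pos_of_mem_ball hy)

end Summit.NavierStokesRegularity.NavierStokesRegularity.Theorems.PoloidalLiouville.AzimuthalCartan.CrossFlow

end
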